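/-
Copyright (c) 2026 the pub-hodgecm-mathlib formalisation cell (harness21).  Prover seat hodgecm-mathlib-LH4-p15 (g0), req620 Track A «(D-RAM) FOUR-FRAME» squad
(STAGE-1b, row (2) of the piece `f_{T₊}`, the (β₂) road (R-36) «PURE-CELL LEDGER, RELATIVE SIGNS»: β₂ sub-dealer LH4-p04 (g8) β₂-BOARD v1.2 rows (L-S1) (LH4-p09 (g9): relative sign
S₁∕D), (L-T) last tower cell, (K-b) (LH4-p16 (g0)); tools ★ `…TowerSignRelationsShallowCardTwo` §1 (LH4-p05 (g8)), ★ p861224 (LH4-p07), ★ p861154 §1 (this seat)), 2026-09-04.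
-/
import Summits.HodgeConjecture.HodgeConjecture.Theorems.F0P3cDyRamTowerSignRelationsShallowCardTwo  -- ★ (LH4-p05 (g8)) §1 `normSign_eq_neg_of_v_sub_eq_of_card_two`; brings ★ p861224 `v_sub_lt_of_v_sub_one_eq_of_card_two`, ★ `two_le_of_v_two_lt_one`, ★ `normSign` API
import Summits.HodgeConjecture.HodgeConjecture.Theorems.F0P3cDyRamConeCellFaceAxis                 -- ★ p861154 (this seat) §1: `valueSetMod_smul_xPlus_eq_of_exists_norm`, `valueSetMod_smul_xPlus_eq_iff_exists_norm`; brings ★ `valueSetMod_smul_xPlus_congr`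
import HarnessLib

/-!
# Crux `H413`, line LH4 «(D-RAM) FOUR-FRAME» — the (β₂) road (R-36) «PURE-CELL LEDGER, RELATIVE SIGNS»: «THE BOUNDARY DIGIT FLIPS THE LABEL AT `q = 2`» — the VALUE-SET face of
# ★ `…TowerSignRelationsShallowCardTwo` §1 for the census's NON-fixed scalars: a scalar `g` at distance EXACTLY `|ϖ|^{2(d−1)}` from a fixed unit `e` has the census letter
# `valueSetMod σ ϖ m* (g • X₊) = valueSetMod σ ϖ m* ((c·e) • X₊)` of the OPPOSITE label class (`c` any fixed non-norm unit); inside the conductor (`|g − e| ≤ |ϖ|^{m*}`) nothing flips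

Cell `hodgecm-mathlib` (D-0151), FLOOR 0, crux item H413 = `stmt-HodgeConjecture-24833`, route of record `HCCMUnconditional`; squad F0∕P3c∕LH4; lane
`--supports stmt-HodgeConjecture-24833 --as helper` (count-neutral; pays NO tier-0 row).  THEOREMS ONLY (no `def`, no instance, no notation, no `sorry`, default heartbeats);
★-only imports; states NO law; (β₂) stays a HYPOTHESIS.  DATUM-FREE: one complete discretely valued field `K` with a ramified quadratic datum `(σ, ϖ, d, t)`, `|2| < 1`, and —
for the flip — a TWO-element residue field and `d` even (so that `m* = 2d − 1` sits one digit above the shell `2(d − 1)`).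

WHY (LH4-p09 (g9) 15:55:38Z (L-S1) plan: «the relative sign `ω(e_S ∕ (f·h_W)) = −1 (δ = 4) ∕ +1 (δ ≥ 6)` — the δ-split coming from the anti-invariant part of μ»; heir LEAD T20-19
(ρ-b) «S₁ = −D₁ at δ = 4, +D₁ at δ ≥ 6», (ρ-c) «T_k = −2·T_{k−1}», (κ-b) «K₀ = −D at δ = 2d»).  ★-cand `…RayDominatedCellLetter` (LH4-p16 (g0)) ∕ ★ p861637 (LH4-p19 (g0)) give
every ray-dominated cell the letter `valueSetMod σ ϖ m ((f·h_W) • X₊)` as long as the depth multiplier `μ` is `E`-rational to the cell's scale (`δ ≥ c + m*` on the cell of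
conductor gap `c`).  ONE DIGIT SHORT of that scale (`δ = c + m* − 1`) the ray scalar becomes `g = f·h_W·N(u)·(1 + η)` with a NON-fixed `η` of EXACT size `|ϖ|^{δ − c} =
|ϖ|^{m* − 1} = |ϖ|^{2(d−1)}` (d even).  THIS FILE turns that digit into the label flip, uniformly for every consumer (S₁, the last tower cell, K₀), in the value-set currency of
★ №3 `valueSetMod ∕ xPlus` and the norm-class dictionary of ★ p861154 §1:
* §1 (any `K`): DISCRETENESS `|x| < |ϖ|ⁿ ⇒ |x| ≤ |ϖ|ⁿ⁺¹`; and at `q = 2` «A SCALAR ON THE SHELL IS A FIXED SHELL UNIT TO ONE MORE DIGIT»: `σe = e`, `|e| = 1`, `|g − e| = |ϖ|^{2k}`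
  (`k ≥ 1`) ⇒ with `e′ := e·(1 + (ϖσϖ)^k)`: `σe′ = e′`, `|e′| = 1`, `|e′ − e| = |ϖ|^{2k}`, `|g − e′| ≤ |ϖ|^{2k+1}` (★ p861224 `v_sub_lt_of_v_sub_one_eq_of_card_two` on `g∕e` and
  `1 + (ϖσϖ)^k`, then §1).
* §2 (S0) «INSIDE THE CONDUCTOR NOTHING FLIPS»: `|g − e| ≤ |ϖ|^m` ⇒ `valueSetMod σ ϖ m (g • X₊) = valueSetMod σ ϖ m (e • X₊)` for ANY `g, e` (★ `valueSetMod_smul_xPlus_congr`, `|t₊| ≤ 1`).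
* §3 (S1) HEAD «THE SHELL FLIP»: `q = 2`, `d` even, `σe = e`, `|e| = 1`, `|g − e| = |ϖ|^{2(d−1)}` EXACTLY, `c` a fixed non-norm unit ⇒
  `valueSetMod σ ϖ m* (g • X₊) = valueSetMod σ ϖ m* ((c·e) • X₊)` (§1 ⊕ (S0) ⊕ ★ `normSign_eq_neg_of_v_sub_eq_of_card_two` ⊕ ★ `normSign_mul_of_fixed` ⊕ ★ p861154
  `valueSetMod_smul_xPlus_eq_of_exists_norm`); (S2) LABEL FORM `valueSetMod σ ϖ m* (g • X₊) ≠ valueSetMod σ ϖ m* (e • X₊)` (★ p861154 `…_eq_iff_exists_norm`).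
* §4 (S3) «THE BOUNDARY CELL CARRIES THE c-TWIST OF THE CLEAN CELL'S LETTER»: two scalars over the same fixed unit `e`, `g_D = e·(1 + η_D)` with `|η_D| ≤ |ϖ|^{m*}` (clean cell)
  and `g_S = e·(1 + η_S)` with `|η_S| = |ϖ|^{2(d−1)}` (boundary cell) ⇒ `valueSetMod σ ϖ m* (g_S • X₊) = valueSetMod σ ϖ m* ((c·g_D) • X₊)` and `≠ valueSetMod σ ϖ m* (g_D • X₊)` —
  LH4-p09's relative sign `−1` at `δ = c + m* − 1`, each consumer supplying its own `η` (S₁ at `δ = 4`; (ρ-c)'s last tower cell; (κ-b)'s `K₀` at `δ = 2d`).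
HONEST LABEL.  Count-neutral norm-class ∕ value-set algebra; nothing printed is asserted; no census law is stated; which cells sit on the shell is the consumers' business
(★-cand `…RayDominatedCellLetter`'s `hlam` one digit short); `HC_CM` is proved only modulo the 7 printed citations (2 remaining named inputs: hLiu418 = `stmt-HodgeConjecture-24832`,
h413 = `stmt-HodgeConjecture-24833`) until rung 0 closes.
## References
* [Serre1979] J.-P. Serre, *Local Fields*, GTM 67 (1979): Ch. V §3 Prop. 5, Cor. 2–3 (norm groups ∕ conductor of a ramified quadratic extension); Ch. XV §2; Ch. I §1 (residue field).
* [Rogawski1990] J. D. Rogawski, *Automorphic Representations of Unitary Groups in Three Variables*, Ann. of Math. Stud. 123 (1990): §4.9 Prop. 4.9.1 (b) p. 55.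
* [LanglandsShelstad1987] R. P. Langlands, D. Shelstad, *On the definition of transfer factors*, Math. Ann. 278 (1987): §1–§3 (κ-signs on a stable class).
-/

set_option autoImplicit false

noncomputable section

namespace Summit.HodgeConjecture.HodgeConjecture.Cruxes.H413.F0P3cDyRamLabelShellFlipCardTwo

open scoped Valued WithZero
open WithZero
open Literature.NumberTheory.Automorphic Literature.NumberTheory.Automorphic.UnitaryThreeFourFrame
open Literature.NumberTheory.LocalFields Literature.NumberTheory.LocalFields.WildQuadraticDatum
open Summit.HodgeConjecture.HodgeConjecture.Cruxes.H413.F0P3cDyRamFourFramePieces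
open Summit.HodgeConjecture.HodgeConjecture.Cruxes.H413.F0P3cDyRamFrameEltOneSlotLabel (valueSetMod_smul_xPlus_congr)
open Summit.HodgeConjecture.HodgeConjecture.Cruxes.H413.F0P3cDyRamConeCellFaceAxis (valueSetMod_smul_xPlus_eq_of_exists_norm valueSetMod_smul_xPlus_eq_iff_exists_norm)
open Summit.HodgeConjecture.HodgeConjecture.Cruxes.H413.F0P3cDyRamCoreHangingEmptyOfCardTwo (v_sub_lt_of_v_sub_one_eq_of_card_two)
open Summit.HodgeConjecture.HodgeConjecture.Cruxes.H413.F0P3cDyRamTowerSignRelationsShallowCardTwo (normSign_eq_neg_of_v_sub_eq_of_card_two)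

variable {K : Type} [Field K] [Valued K ℤᵐ⁰]

/-! ## §1 Discreteness, and the `q = 2` step «a scalar on the shell is a fixed shell unit to one more digit» -/

/-- **DISCRETENESS**: `|ϖ| = exp(−1)` and `|x| < |ϖ|ⁿ` ⇒ `|x| ≤ |ϖ|ⁿ⁺¹`. [cite: Serre1979, Ch. I §1] -/
theorem v_le_pow_succ_of_lt {ϖ x : K} (hϖ : Valued.v ϖ = exp (-1 : ℤ)) {n : ℕ} (h : Valued.v x < Valued.v ϖ ^ n) :
    Valued.v x ≤ Valued.v ϖ ^ (n + 1) := by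
  by_cases hx : x = 0
  · rw [hx, map_zero]; exact zero_le
  obtain ⟨k, hk⟩ : ∃ k : ℤ, Valued.v x = exp k := ⟨_, (exp_log ((Valuation.ne_zero_iff _).2 hx)).symm⟩
  rw [hk, v_varpi_pow hϖ, exp_lt_exp] at h
  rw [hk, v_varpi_pow hϖ, exp_le_exp]
  push_cast at h ⊢
  omega

/-- **AT `q = 2`, A SCALAR ON THE SHELL `|g − e| = |ϖ|^{2k}` AROUND A FIXED UNIT `e` IS THE FIXED SHELL UNIT `e′ = e·(1 + (ϖσϖ)^k)` TO ONE MORE DIGIT**: `σe′ = e′`, `|e′| = 1`,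
`|e′ − e| = |ϖ|^{2k}` and `|g − e′| ≤ |ϖ|^{2k+1}` (`k ≥ 1`; the two units `g∕e` and `1 + (ϖσϖ)^k` lie on the same shell, hence agree to a further digit when the residue field
has two elements, ★ p861224). [cite: Serre1979, Ch. I §1; Ch. V §3 Prop. 5, Cor. 2–3] -/
theorem exists_fixed_shell_unit_near_of_card_two [Fintype 𝓀[K]] (hq : Fintype.card 𝓀[K] = 2) {σ : K →+* K} {ϖ : K}
    (hσσ : ∀ x, σ (σ x) = x) (hvσ : ∀ a, Valued.v (σ a) = Valued.v a) (hϖ : Valued.v ϖ = exp (-1 : ℤ))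
    {e g : K} (hσe : σ e = e) (he1 : Valued.v e = 1) {k : ℕ} (hk : 1 ≤ k) (hge : Valued.v (g - e) = Valued.v ϖ ^ (2 * k)) :
    ∃ e' : K, σ e' = e' ∧ Valued.v e' = 1 ∧ Valued.v (e' - e) = Valued.v ϖ ^ (2 * k) ∧ Valued.v (g - e') ≤ Valued.v ϖ ^ (2 * k + 1) := by
  have hϖ0 : ϖ ≠ 0 := fun h0 => by rw [h0, map_zero] at hϖ; exact (coe_ne_zero hϖ.symm).elim
  have hϖ1 : Valued.v ϖ < 1 := by rw [hϖ, ← exp_zero, exp_lt_exp]; norm_num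
  have he0 : e ≠ 0 := fun h0 => by rw [h0, map_zero] at he1; exact zero_ne_one he1
  have hN : Valued.v ((ϖ * σ ϖ) ^ k) = Valued.v ϖ ^ (2 * k) := by rw [map_pow, map_mul, hvσ, ← pow_two, ← pow_mul]
  have hNlt : Valued.v ((ϖ * σ ϖ) ^ k) < 1 := by
    rw [hN]; exact pow_lt_one₀ zero_le hϖ1 (by omega)
  refine ⟨e * (1 + (ϖ * σ ϖ) ^ k), ?_, ?_, ?_, ?_⟩
  · rw [map_mul, hσe, map_add, map_one, map_pow, map_mul, hσσ, mul_comm (σ ϖ) ϖ]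
  · rw [map_mul, he1, one_mul]
    have h := Valuation.map_add_eq_of_lt_left (v := Valued.v) (x := (1 : K)) (y := (ϖ * σ ϖ) ^ k) (by rw [Valuation.map_one]; exact hNlt)
    rw [h, Valuation.map_one]
  · rw [show e * (1 + (ϖ * σ ϖ) ^ k) - e = e * (ϖ * σ ϖ) ^ k by ring, map_mul, he1, one_mul, hN]
  · -- `g∕e` and `1 + (ϖσϖ)^k` lie on the same shell
    have hα : Valued.v (g * e⁻¹ - 1) = Valued.v ϖ ^ (2 * k) := by
      rw [show g * e⁻¹ - 1 = (g - e) * e⁻¹ by field_simp, map_mul, map_inv₀, he1, inv_one, mul_one, hge]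
    have hβ : Valued.v (1 + (ϖ * σ ϖ) ^ k - 1) = Valued.v ϖ ^ (2 * k) := by rw [add_sub_cancel_left, hN]
    have hlt := v_sub_lt_of_v_sub_one_eq_of_card_two hq hϖ0 hα hβ
    have hle := v_le_pow_succ_of_lt hϖ hlt
    rw [show g - e * (1 + (ϖ * σ ϖ) ^ k) = e * (g * e⁻¹ - (1 + (ϖ * σ ϖ) ^ k)) by field_simp, map_mul, he1, one_mul]
    exact hle

/-! ## §2 (S0) Inside the conductor nothing flips -/

/-- **(S0) «INSIDE THE LEVEL NOTHING FLIPS»**: for ANY scalars `g, e` (fixed or not) with `|g − e| ≤ |ϖ|^m`, `valueSetMod σ ϖ m (g • X₊) = valueSetMod σ ϖ m (e • X₊)` — the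
level-`m` value set only reads the scalar mod `ϖ^m` (★ `valueSetMod_smul_xPlus_congr`; `|t₊| = |ϖ|^{d mod 2} ≤ 1`). [cite: Serre1979, Ch. V §3 Cor. 3] -/
theorem valueSetMod_smul_xPlus_eq_of_v_sub_le {σ : K →+* K} (hvσ : ∀ a, Valued.v (σ a) = Valued.v a) {ϖ : K} (hϖ : Valued.v ϖ = exp (-1 : ℤ)) {d : ℕ}
    (hd : Valued.v (ϖ - σ ϖ) = Valued.v ϖ ^ d) (m : ℕ) {g e : K} (hge : Valued.v (g - e) ≤ Valued.v ϖ ^ m) :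
    valueSetMod σ ϖ m (g • xPlus σ ϖ d) = valueSetMod σ ϖ m (e • xPlus σ ϖ d) := by
  have hϖ0 : ϖ ≠ 0 := fun h0 => by rw [h0, map_zero] at hϖ; exact (coe_ne_zero hϖ.symm).elim
  have hvϖ0 : Valued.v ϖ ≠ 0 := (Valuation.ne_zero_iff _).2 hϖ0
  have hϖ1 : Valued.v ϖ ≤ 1 := by rw [hϖ, ← exp_zero, exp_le_exp]; norm_num
  have hpm0 : Valued.v (ϖ ^ m) ≠ 0 := by rw [map_pow]; exact pow_ne_zero _ hvϖ0
  -- `|t₊| ≤ 1`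
  have ht : Valued.v ((ϖ - σ ϖ) * ((ϖ * σ ϖ) ^ ((d - d % 2) / 2))⁻¹) ≤ 1 := by
    rw [map_mul, map_inv₀, hd, map_pow, map_mul, hvσ, ← pow_two, ← pow_mul]
    have h2 : 2 * ((d - d % 2) / 2) ≤ d := by omega
    rw [mul_inv_le_iff₀ (pow_pos (zero_lt_iff.2 hvϖ0) _), one_mul]
    exact pow_le_pow_right_of_le_one' hϖ1 h2
  refine valueSetMod_smul_xPlus_congr hvσ ϖ d m ?_
  rw [map_mul, map_inv₀, map_mul]
  calc (Valued.v (ϖ ^ m))⁻¹ * (Valued.v (g - e) * Valued.v ((ϖ - σ ϖ) * ((ϖ * σ ϖ) ^ ((d - d % 2) / 2))⁻¹))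
      ≤ (Valued.v (ϖ ^ m))⁻¹ * (Valued.v (ϖ ^ m) * 1) := by rw [map_pow]; gcongr
    _ = 1 := by rw [mul_one, inv_mul_cancel₀ hpm0]

/-! ## §3 (S1) The shell flip and (S2) its label form -/

/-- **(S1) HEAD — «THE SHELL FLIP».**  At a ramified datum `(σ, ϖ, d, t)` on a complete `K` with `|2| < 1`, a TWO-element residue field and `d` even: if `e` is a σ-fixed unit, `g` ANY scalar
with `|g − e| = |ϖ|^{2(d−1)}` EXACTLY, and `c` a σ-fixed non-norm unit, then `valueSetMod σ ϖ m* (g • X₊) = valueSetMod σ ϖ m* ((c·e) • X₊)` (`m* = mstarOfRecord d = 2d − 1`):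
`g ≡ e′ := e(1 + (ϖσϖ)^{d−1})` to digit `m*` (§1), `ω(e′) = −ω(e)` (★ ShallowCardTwo §1), so `e′∕(ce)` is a norm (★ `normSign_mul_of_fixed`) and the dictionary ★ p861154 §1 closes.
[cite: Serre1979, Ch. V §3 Prop. 5, Cor. 2–3; Ch. XV §2] [cite: Rogawski1990, §4.9 Prop. 4.9.1 (b) p. 55] [cite: LanglandsShelstad1987, §1–§3] -/
theorem valueSetMod_smul_xPlus_eq_twist_of_v_sub_eq_shell [CompleteSpace K] [Fintype 𝓀[K]] {σ : K →+* K} {ϖ : K} {d t : ℕ}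
    (hD : IsRamifiedQuadraticDatum σ ϖ d t) (h2v : Valued.v (2 : K) < 1) (hq : Fintype.card 𝓀[K] = 2) (hd2 : d % 2 = 0)
    {e g c : K} (hσe : σ e = e) (he1 : Valued.v e = 1) (hge : Valued.v (g - e) = Valued.v ϖ ^ (2 * (d - 1)))
    (hσc : σ c = c) (hc1 : Valued.v c = 1) (hcN : ¬ ∃ z : K, z * σ z = c) :
    valueSetMod σ ϖ (mstarOfRecord d) (g • xPlus σ ϖ d) = valueSetMod σ ϖ (mstarOfRecord d) ((c * e) • xPlus σ ϖ d) := by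
  obtain ⟨hσσ, hvσ, hϖ, hfix, hd, h1d, ht⟩ := id hD
  have h2d : 2 ≤ d := two_le_of_v_two_lt_one hσσ hvσ hfix hϖ hd ht h2v
  have hm : mstarOfRecord d = 2 * (d - 1) + 1 := by
    show d % 2 + 2 * d - 1 = 2 * (d - 1) + 1
    omega
  have he0 : e ≠ 0 := fun h0 => by rw [h0, map_zero] at he1; exact zero_ne_one he1
  have hc0 : c ≠ 0 := fun h0 => by rw [h0, map_zero] at hc1; exact zero_ne_one hc1
  -- §1: the fixed shell unit `e′` one digit closer to `g`
  obtain ⟨e', hσe', he'1, he'e, hge'⟩ := exists_fixed_shell_unit_near_of_card_two hq hσσ hvσ hϖ hσe he1 (k := d - 1) (by omega) hge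
  have he'0 : e' ≠ 0 := fun h0 => by rw [h0, map_zero] at he'1; exact zero_ne_one he'1
  -- (S0): `g` and `e′` have the same level-`m*` value set
  have h0 : valueSetMod σ ϖ (mstarOfRecord d) (g • xPlus σ ϖ d) = valueSetMod σ ϖ (mstarOfRecord d) (e' • xPlus σ ϖ d) :=
    valueSetMod_smul_xPlus_eq_of_v_sub_le hvσ hϖ hd _ (by rw [hm]; exact hge')
  rw [h0]
  -- `ω(e′) = −ω(e)` on the shell, so `e′∕(c·e)` is a norm
  have hω : normSign σ e' = -normSign σ e :=
    normSign_eq_neg_of_v_sub_eq_of_card_two hD h2v hq hσe he1 hσe' he'0 (by rw [Valuation.map_sub_swap, he'e])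
  have hωc : normSign σ c = -1 := normSign_of_not_isNorm σ hcN
  have hσq : σ (e' * (c * e)⁻¹) = e' * (c * e)⁻¹ := by rw [map_mul, map_inv₀, map_mul, hσe', hσc, hσe]
  have hq0 : e' * (c * e)⁻¹ ≠ 0 := mul_ne_zero he'0 (inv_ne_zero (mul_ne_zero hc0 he0))
  have hσce : σ (c * e) = c * e := by rw [map_mul, hσc, hσe]
  have hprod : normSign σ e' = normSign σ (e' * (c * e)⁻¹) * (normSign σ c * normSign σ e) := by
    rw [← normSign_mul_of_fixed hD hσc hσe hc0 he0, ← normSign_mul_of_fixed hD hσq hσce hq0 (mul_ne_zero hc0 he0),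
      inv_mul_cancel_right₀ (mul_ne_zero hc0 he0)]
  have hcases : ∀ x : K, normSign σ x = 1 ∨ normSign σ x = -1 := fun x => by
    unfold normSign; split_ifs
    · exact Or.inl rfl
    · exact Or.inr rfl
  have hωq : normSign σ (e' * (c * e)⁻¹) = 1 := by
    rcases hcases (e' * (c * e)⁻¹) with h2 | h2
    · exact h2
    · exfalso
      rw [hω, hωc, h2] at hprod
      rcases hcases e with h1 | h1 <;> rw [h1] at hprod <;> norm_num at hprod
  have hwit : ∃ z : K, z * σ z = e' * (c * e)⁻¹ := by
    by_contra hx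
    rw [normSign_of_not_isNorm σ hx] at hωq
    norm_num at hωq
  exact valueSetMod_smul_xPlus_eq_of_exists_norm hvσ ϖ d _ he'1 (by rw [map_mul, hc1, he1, mul_one]) hwit

/-- **(S2) LABEL FORM — «THE SHELL SCALAR HAS THE OTHER LABEL»**: under the hypotheses of (S1) (no `c` needed), `valueSetMod σ ϖ m* (g • X₊) ≠ valueSetMod σ ϖ m* (e • X₊)`.
(★ `exists_fixed_unit_not_norm_v_sub_one_le` supplies a fixed non-norm unit `c`; (S1); and `VS((ce)•X₊) = VS(e•X₊)` would make `c` a norm by ★ p861154 `…_eq_iff_exists_norm`.)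
[cite: Serre1979, Ch. V §3 Prop. 5, Cor. 2–3; Ch. XV §2] [cite: Rogawski1990, §4.9 Prop. 4.9.1 (b) p. 55] -/
theorem valueSetMod_smul_xPlus_ne_of_v_sub_eq_shell [CompleteSpace K] [Fintype 𝓀[K]] {σ : K →+* K} {ϖ : K} {d t : ℕ}
    (hD : IsRamifiedQuadraticDatum σ ϖ d t) (h2v : Valued.v (2 : K) < 1) (hq : Fintype.card 𝓀[K] = 2) (hd2 : d % 2 = 0)
    {e g : K} (hσe : σ e = e) (he1 : Valued.v e = 1) (hge : Valued.v (g - e) = Valued.v ϖ ^ (2 * (d - 1))) :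
    valueSetMod σ ϖ (mstarOfRecord d) (g • xPlus σ ϖ d) ≠ valueSetMod σ ϖ (mstarOfRecord d) (e • xPlus σ ϖ d) := by
  obtain ⟨hσσ, hvσ, hϖ, hfix, hd, h1d, ht⟩ := id hD
  haveI := Literature.NumberTheory.LocalFields.isAdicComplete_valuedInteger_of_completeSpace (K := K) hϖ
  obtain ⟨c, hσc, hc1, -, hcN⟩ := exists_fixed_unit_not_norm_v_sub_one_le hD h2v
  have he0 : e ≠ 0 := fun h0 => by rw [h0, map_zero] at he1; exact zero_ne_one he1
  rw [valueSetMod_smul_xPlus_eq_twist_of_v_sub_eq_shell hD h2v hq hd2 hσe he1 hge hσc hc1 hcN]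
  intro hEq
  have hce : σ (c * e) = c * e := by rw [map_mul, hσc, hσe]
  have hce1 : Valued.v (c * e) = 1 := by rw [map_mul, hc1, he1, mul_one]
  obtain ⟨z, hz⟩ := (valueSetMod_smul_xPlus_eq_iff_exists_norm hD hce hce1 hσe he1).1 hEq
  exact hcN ⟨z, by rw [hz, mul_inv_cancel_right₀ he0]⟩

/-! ## §4 (S3) The boundary cell carries the `c`-twist of the clean cell's letter -/

/-- **(S3) «THE BOUNDARY CELL'S LETTER IS THE c-TWIST OF THE CLEAN CELL'S» — LH4-p09 (g9)'s relative sign `−1` at `δ = c + m* − 1`.**  Two census scalars over the SAME fixed unit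
`e` (= `f·h_W` up to a unit norm): `g_D` with `|g_D − e| ≤ |ϖ|^{m*}` (the CLEAN cell: ★-cand `…RayDominatedCellLetter`'s `hlam` holds) and `g_S` with `|g_S − e| = |ϖ|^{2(d−1)}`
EXACTLY (the BOUNDARY cell: `hlam` one digit short, the correction `jE(μ₁)·Tr_ρ(ζ∕D₀)` of exact size `|ϖ|^{δ−c}`).  Then at `q = 2`, `d` even:
`valueSetMod σ ϖ m* (g_S • X₊) = valueSetMod σ ϖ m* ((c·g_D) • X₊)` for every fixed non-norm unit `c`, and `valueSetMod σ ϖ m* (g_S • X₊) ≠ valueSetMod σ ϖ m* (g_D • X₊)`.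
[cite: Serre1979, Ch. V §3 Prop. 5, Cor. 2–3; Ch. XV §2] [cite: Rogawski1990, §4.9 Prop. 4.9.1 (b) p. 55] [cite: LanglandsShelstad1987, §1–§3] -/
theorem valueSetMod_boundary_eq_twist_clean_of_card_two [CompleteSpace K] [Fintype 𝓀[K]] {σ : K →+* K} {ϖ : K} {d t : ℕ}
    (hD : IsRamifiedQuadraticDatum σ ϖ d t) (h2v : Valued.v (2 : K) < 1) (hq : Fintype.card 𝓀[K] = 2) (hd2 : d % 2 = 0)
    {e gD gS c : K} (hσe : σ e = e) (he1 : Valued.v e = 1)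
    (hD' : Valued.v (gD - e) ≤ Valued.v ϖ ^ mstarOfRecord d) (hS : Valued.v (gS - e) = Valued.v ϖ ^ (2 * (d - 1)))
    (hσc : σ c = c) (hc1 : Valued.v c = 1) (hcN : ¬ ∃ z : K, z * σ z = c) :
    valueSetMod σ ϖ (mstarOfRecord d) (gS • xPlus σ ϖ d) = valueSetMod σ ϖ (mstarOfRecord d) ((c * gD) • xPlus σ ϖ d) ∧
      valueSetMod σ ϖ (mstarOfRecord d) (gS • xPlus σ ϖ d) ≠ valueSetMod σ ϖ (mstarOfRecord d) (gD • xPlus σ ϖ d) := by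
  obtain ⟨hσσ, hvσ, hϖ, hfix, hd, h1d, ht⟩ := id hD
  -- the clean scalar and its twist read like `e` and `c·e` at level `m*`
  have hDe : valueSetMod σ ϖ (mstarOfRecord d) (gD • xPlus σ ϖ d) = valueSetMod σ ϖ (mstarOfRecord d) (e • xPlus σ ϖ d) :=
    valueSetMod_smul_xPlus_eq_of_v_sub_le hvσ hϖ hd _ hD'
  have hcDe : valueSetMod σ ϖ (mstarOfRecord d) ((c * gD) • xPlus σ ϖ d) = valueSetMod σ ϖ (mstarOfRecord d) ((c * e) • xPlus σ ϖ d) := by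
    refine valueSetMod_smul_xPlus_eq_of_v_sub_le hvσ hϖ hd _ ?_
    rw [← mul_sub, map_mul, hc1, one_mul]
    exact hD'
  refine ⟨?_, ?_⟩
  · rw [hcDe]
    exact valueSetMod_smul_xPlus_eq_twist_of_v_sub_eq_shell hD h2v hq hd2 hσe he1 hS hσc hc1 hcN
  · rw [hDe]
    exact valueSetMod_smul_xPlus_ne_of_v_sub_eq_shell hD h2v hq hd2 hσe he1 hS

/-- **(S3′) RELATIVE-PERTURBATION FORM** (the shape the ray scalar comes in): `g_D = e·(1 + η_D)`, `|η_D| ≤ |ϖ|^{m*}`, `g_S = e·(1 + η_S)`, `|η_S| = |ϖ|^{2(d−1)}`, `e` a fixed unit ⇒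
the conclusions of (S3). [cite: Serre1979, Ch. V §3 Prop. 5, Cor. 2–3; Ch. XV §2] [cite: Rogawski1990, §4.9 Prop. 4.9.1 (b) p. 55] -/
theorem valueSetMod_boundary_eq_twist_clean_of_rel_of_card_two [CompleteSpace K] [Fintype 𝓀[K]] {σ : K →+* K} {ϖ : K} {d t : ℕ}
    (hD : IsRamifiedQuadraticDatum σ ϖ d t) (h2v : Valued.v (2 : K) < 1) (hq : Fintype.card 𝓀[K] = 2) (hd2 : d % 2 = 0)
    {e ηD ηS c : K} (hσe : σ e = e) (he1 : Valued.v e = 1)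
    (hηD : Valued.v ηD ≤ Valued.v ϖ ^ mstarOfRecord d) (hηS : Valued.v ηS = Valued.v ϖ ^ (2 * (d - 1)))
    (hσc : σ c = c) (hc1 : Valued.v c = 1) (hcN : ¬ ∃ z : K, z * σ z = c) :
    valueSetMod σ ϖ (mstarOfRecord d) ((e * (1 + ηS)) • xPlus σ ϖ d) = valueSetMod σ ϖ (mstarOfRecord d) ((c * (e * (1 + ηD))) • xPlus σ ϖ d) ∧
      valueSetMod σ ϖ (mstarOfRecord d) ((e * (1 + ηS)) • xPlus σ ϖ d) ≠ valueSetMod σ ϖ (mstarOfRecord d) ((e * (1 + ηD)) • xPlus σ ϖ d) := by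
  refine valueSetMod_boundary_eq_twist_clean_of_card_two hD h2v hq hd2 hσe he1 ?_ ?_ hσc hc1 hcN
  · rw [show e * (1 + ηD) - e = e * ηD by ring, map_mul, he1, one_mul]; exact hηD
  · rw [show e * (1 + ηS) - e = e * ηS by ring, map_mul, he1, one_mul]; exact hηS

/-! ## §5 (ED. 2) ANY PARITY — the `t₊`-digit removes the evenness hypothesis

At `q = 2` §1 gives `g ≡ e′ (mod ϖ^{2d−1})` for EVERY `d ≥ 2`; the congruence ★ `valueSetMod_smul_xPlus_congr` reads `(g − e′)·t₊` with `|t₊| = |ϖ|^{d mod 2}`, and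
`2d − 1 + d mod 2 = m*` in both parities.  So (S1)∕(S2)∕(S3′) hold WITHOUT `d % 2 = 0` — LH4-p16 (g0) MECH-K0 v2 (RamM, `d = 3`, `m* = 6`): the near cell `K₀` at `δ = 2d` has
`e₀ = main·(1 + η)`, `|η| = |ϖ|^{2(d−1)}` EXACTLY on every vertex, and (κ-b) «K₀ = −D» is (S3″) below. -/

/-- **`|t₊| = |ϖ|^{d mod 2}`** for the reference skew scalar `t₊ = (ϖ − σϖ)·((ϖσϖ)^{⌊d∕2⌋})⁻¹` (`σ` isometric, `|ϖ − σϖ| = |ϖ|^d`). [cite: Serre1979, Ch. V §3 Cor. 3] -/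
theorem v_refSkew_eq {σ : K →+* K} (hvσ : ∀ a, Valued.v (σ a) = Valued.v a) {ϖ : K} (hϖ : Valued.v ϖ = exp (-1 : ℤ)) {d : ℕ}
    (hd : Valued.v (ϖ - σ ϖ) = Valued.v ϖ ^ d) :
    Valued.v ((ϖ - σ ϖ) * ((ϖ * σ ϖ) ^ ((d - d % 2) / 2))⁻¹) = Valued.v ϖ ^ (d % 2) := by
  have hvϖ0 : Valued.v ϖ ≠ 0 := by rw [hϖ]; exact exp_ne_zero
  have hk : 2 * ((d - d % 2) / 2) + d % 2 = d := by omega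
  rw [map_mul, map_inv₀, hd, map_pow, map_mul, hvσ, ← pow_two, ← pow_mul]
  nth_rewrite 1 [← hk]
  rw [pow_add, mul_comm (Valued.v ϖ ^ (2 * ((d - d % 2) / 2))) (Valued.v ϖ ^ (d % 2)),
    mul_inv_cancel_right₀ (pow_ne_zero _ hvϖ0)]

/-- **(S0″) «INSIDE THE LEVEL NOTHING FLIPS», SHARP FORM**: `|g − e| ≤ |ϖ|ⁿ` with `m ≤ n + d mod 2` ⇒ `valueSetMod σ ϖ m (g • X₊) = valueSetMod σ ϖ m (e • X₊)` — for odd `d` the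
skew scalar `t₊` contributes one more digit. [cite: Serre1979, Ch. V §3 Cor. 3] -/
theorem valueSetMod_smul_xPlus_eq_of_v_sub_le_pred {σ : K →+* K} (hvσ : ∀ a, Valued.v (σ a) = Valued.v a) {ϖ : K} (hϖ : Valued.v ϖ = exp (-1 : ℤ)) {d : ℕ}
    (hd : Valued.v (ϖ - σ ϖ) = Valued.v ϖ ^ d) {m n : ℕ} (hmn : m ≤ n + d % 2) {g e : K} (hge : Valued.v (g - e) ≤ Valued.v ϖ ^ n) :
    valueSetMod σ ϖ m (g • xPlus σ ϖ d) = valueSetMod σ ϖ m (e • xPlus σ ϖ d) := by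
  have hϖ0 : ϖ ≠ 0 := fun h0 => by rw [h0, map_zero] at hϖ; exact (coe_ne_zero hϖ.symm).elim
  have hvϖ0 : Valued.v ϖ ≠ 0 := (Valuation.ne_zero_iff _).2 hϖ0
  have hϖ1 : Valued.v ϖ ≤ 1 := by rw [hϖ, ← exp_zero, exp_le_exp]; norm_num
  have hpm0 : Valued.v (ϖ ^ m) ≠ 0 := by rw [map_pow]; exact pow_ne_zero _ hvϖ0
  refine valueSetMod_smul_xPlus_congr hvσ ϖ d m ?_
  rw [map_mul, map_inv₀, map_mul, v_refSkew_eq hvσ hϖ hd]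
  calc (Valued.v (ϖ ^ m))⁻¹ * (Valued.v (g - e) * Valued.v ϖ ^ (d % 2))
      ≤ (Valued.v (ϖ ^ m))⁻¹ * (Valued.v ϖ ^ n * Valued.v ϖ ^ (d % 2)) := by gcongr
    _ = (Valued.v (ϖ ^ m))⁻¹ * Valued.v ϖ ^ (n + d % 2) := by rw [pow_add]
    _ ≤ (Valued.v (ϖ ^ m))⁻¹ * Valued.v ϖ ^ m := mul_le_mul_right (pow_le_pow_right_of_le_one' hϖ1 hmn) _
    _ = 1 := by rw [← map_pow, inv_mul_cancel₀ hpm0]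

/-- **(S1″) HEAD, ANY PARITY — «THE SHELL FLIP».**  As (S1) WITHOUT `d % 2 = 0`: at `q = 2`, for a σ-fixed unit `e`, ANY `g` with `|g − e| = |ϖ|^{2(d−1)}` EXACTLY and a σ-fixed
non-norm unit `c`, `valueSetMod σ ϖ m* (g • X₊) = valueSetMod σ ϖ m* ((c·e) • X₊)` (`m* = mstarOfRecord d = d%2 + 2d − 1`; §1 gives `g ≡ e′ (mod ϖ^{2d−1})`, (S0″) supplies
the last digit from `t₊`). [cite: Serre1979, Ch. V §3 Prop. 5, Cor. 2–3; Ch. XV §2] [cite: Rogawski1990, §4.9 Prop. 4.9.1 (b) p. 55] [cite: LanglandsShelstad1987, §1–§3] -/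
theorem valueSetMod_smul_xPlus_eq_twist_of_v_sub_eq_shell' [CompleteSpace K] [Fintype 𝓀[K]] {σ : K →+* K} {ϖ : K} {d t : ℕ}
    (hD : IsRamifiedQuadraticDatum σ ϖ d t) (h2v : Valued.v (2 : K) < 1) (hq : Fintype.card 𝓀[K] = 2)
    {e g c : K} (hσe : σ e = e) (he1 : Valued.v e = 1) (hge : Valued.v (g - e) = Valued.v ϖ ^ (2 * (d - 1)))
    (hσc : σ c = c) (hc1 : Valued.v c = 1) (hcN : ¬ ∃ z : K, z * σ z = c) :
    valueSetMod σ ϖ (mstarOfRecord d) (g • xPlus σ ϖ d) = valueSetMod σ ϖ (mstarOfRecord d) ((c * e) • xPlus σ ϖ d) := by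
  obtain ⟨hσσ, hvσ, hϖ, hfix, hd, h1d, ht⟩ := id hD
  have h2d : 2 ≤ d := two_le_of_v_two_lt_one hσσ hvσ hfix hϖ hd ht h2v
  have hm : mstarOfRecord d ≤ (2 * (d - 1) + 1) + d % 2 := by
    show d % 2 + 2 * d - 1 ≤ _
    omega
  have he0 : e ≠ 0 := fun h0 => by rw [h0, map_zero] at he1; exact zero_ne_one he1
  have hc0 : c ≠ 0 := fun h0 => by rw [h0, map_zero] at hc1; exact zero_ne_one hc1
  obtain ⟨e', hσe', he'1, he'e, hge'⟩ := exists_fixed_shell_unit_near_of_card_two hq hσσ hvσ hϖ hσe he1 (k := d - 1) (by omega) hge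
  have he'0 : e' ≠ 0 := fun h0 => by rw [h0, map_zero] at he'1; exact zero_ne_one he'1
  have h0 : valueSetMod σ ϖ (mstarOfRecord d) (g • xPlus σ ϖ d) = valueSetMod σ ϖ (mstarOfRecord d) (e' • xPlus σ ϖ d) :=
    valueSetMod_smul_xPlus_eq_of_v_sub_le_pred hvσ hϖ hd hm hge'
  rw [h0]
  have hω : normSign σ e' = -normSign σ e :=
    normSign_eq_neg_of_v_sub_eq_of_card_two hD h2v hq hσe he1 hσe' he'0 (by rw [Valuation.map_sub_swap, he'e])
  have hωc : normSign σ c = -1 := normSign_of_not_isNorm σ hcN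
  have hσq : σ (e' * (c * e)⁻¹) = e' * (c * e)⁻¹ := by rw [map_mul, map_inv₀, map_mul, hσe', hσc, hσe]
  have hq0 : e' * (c * e)⁻¹ ≠ 0 := mul_ne_zero he'0 (inv_ne_zero (mul_ne_zero hc0 he0))
  have hσce : σ (c * e) = c * e := by rw [map_mul, hσc, hσe]
  have hprod : normSign σ e' = normSign σ (e' * (c * e)⁻¹) * (normSign σ c * normSign σ e) := by
    rw [← normSign_mul_of_fixed hD hσc hσe hc0 he0, ← normSign_mul_of_fixed hD hσq hσce hq0 (mul_ne_zero hc0 he0),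
      inv_mul_cancel_right₀ (mul_ne_zero hc0 he0)]
  have hcases : ∀ x : K, normSign σ x = 1 ∨ normSign σ x = -1 := fun x => by
    unfold normSign; split_ifs
    · exact Or.inl rfl
    · exact Or.inr rfl
  have hωq : normSign σ (e' * (c * e)⁻¹) = 1 := by
    rcases hcases (e' * (c * e)⁻¹) with h2 | h2
    · exact h2
    · exfalso
      rw [hω, hωc, h2] at hprod
      rcases hcases e with h1 | h1 <;> rw [h1] at hprod <;> norm_num at hprod
  have hwit : ∃ z : K, z * σ z = e' * (c * e)⁻¹ := by
    by_contra hx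
    rw [normSign_of_not_isNorm σ hx] at hωq
    norm_num at hωq
  exact valueSetMod_smul_xPlus_eq_of_exists_norm hvσ ϖ d _ he'1 (by rw [map_mul, hc1, he1, mul_one]) hwit

/-- **(S2″) LABEL FORM, ANY PARITY**: under (S1″)'s hypotheses (no `c`), `valueSetMod σ ϖ m* (g • X₊) ≠ valueSetMod σ ϖ m* (e • X₊)`.
[cite: Serre1979, Ch. V §3 Prop. 5, Cor. 2–3; Ch. XV §2] [cite: Rogawski1990, §4.9 Prop. 4.9.1 (b) p. 55] -/
theorem valueSetMod_smul_xPlus_ne_of_v_sub_eq_shell' [CompleteSpace K] [Fintype 𝓀[K]] {σ : K →+* K} {ϖ : K} {d t : ℕ}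
    (hD : IsRamifiedQuadraticDatum σ ϖ d t) (h2v : Valued.v (2 : K) < 1) (hq : Fintype.card 𝓀[K] = 2)
    {e g : K} (hσe : σ e = e) (he1 : Valued.v e = 1) (hge : Valued.v (g - e) = Valued.v ϖ ^ (2 * (d - 1))) :
    valueSetMod σ ϖ (mstarOfRecord d) (g • xPlus σ ϖ d) ≠ valueSetMod σ ϖ (mstarOfRecord d) (e • xPlus σ ϖ d) := by
  obtain ⟨hσσ, hvσ, hϖ, hfix, hd, h1d, ht⟩ := id hD
  haveI := Literature.NumberTheory.LocalFields.isAdicComplete_valuedInteger_of_completeSpace (K := K) hϖ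
  obtain ⟨c, hσc, hc1, -, hcN⟩ := exists_fixed_unit_not_norm_v_sub_one_le hD h2v
  have he0 : e ≠ 0 := fun h0 => by rw [h0, map_zero] at he1; exact zero_ne_one he1
  rw [valueSetMod_smul_xPlus_eq_twist_of_v_sub_eq_shell' hD h2v hq hσe he1 hge hσc hc1 hcN]
  intro hEq
  have hce : σ (c * e) = c * e := by rw [map_mul, hσc, hσe]
  have hce1 : Valued.v (c * e) = 1 := by rw [map_mul, hc1, he1, mul_one]
  obtain ⟨z, hz⟩ := (valueSetMod_smul_xPlus_eq_iff_exists_norm hD hce hce1 hσe he1).1 hEq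
  exact hcN ⟨z, by rw [hz, mul_inv_cancel_right₀ he0]⟩

/-- **(S3″) «THE BOUNDARY CELL CARRIES THE c-TWIST OF THE CLEAN CELL'S LETTER», ANY PARITY, relative-perturbation form**: `g_D = e·(1 + η_D)`, `|η_D| ≤ |ϖ|^{m*}`; `g_S = e·(1 + η_S)`,
`|η_S| = |ϖ|^{2(d−1)}`; `e` a σ-fixed unit; `c` a σ-fixed non-norm unit ⇒ `valueSetMod σ ϖ m* (g_S • X₊) = valueSetMod σ ϖ m* ((c·g_D) • X₊)` and `≠ valueSetMod σ ϖ m* (g_D • X₊)`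
(LH4-p16 (g0) (κ-b) «K₀ = −D at δ = 2d», RamM `d = 3`). [cite: Serre1979, Ch. V §3 Prop. 5, Cor. 2–3; Ch. XV §2] [cite: Rogawski1990, §4.9 Prop. 4.9.1 (b) p. 55] -/
theorem valueSetMod_boundary_eq_twist_clean_of_rel_of_card_two' [CompleteSpace K] [Fintype 𝓀[K]] {σ : K →+* K} {ϖ : K} {d t : ℕ}
    (hD : IsRamifiedQuadraticDatum σ ϖ d t) (h2v : Valued.v (2 : K) < 1) (hq : Fintype.card 𝓀[K] = 2)
    {e ηD ηS c : K} (hσe : σ e = e) (he1 : Valued.v e = 1)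
    (hηD : Valued.v ηD ≤ Valued.v ϖ ^ mstarOfRecord d) (hηS : Valued.v ηS = Valued.v ϖ ^ (2 * (d - 1)))
    (hσc : σ c = c) (hc1 : Valued.v c = 1) (hcN : ¬ ∃ z : K, z * σ z = c) :
    valueSetMod σ ϖ (mstarOfRecord d) ((e * (1 + ηS)) • xPlus σ ϖ d) = valueSetMod σ ϖ (mstarOfRecord d) ((c * (e * (1 + ηD))) • xPlus σ ϖ d) ∧
      valueSetMod σ ϖ (mstarOfRecord d) ((e * (1 + ηS)) • xPlus σ ϖ d) ≠ valueSetMod σ ϖ (mstarOfRecord d) ((e * (1 + ηD)) • xPlus σ ϖ d) := by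
  obtain ⟨hσσ, hvσ, hϖ, hfix, hd, h1d, ht⟩ := id hD
  have hS : Valued.v (e * (1 + ηS) - e) = Valued.v ϖ ^ (2 * (d - 1)) := by
    rw [show e * (1 + ηS) - e = e * ηS by ring, map_mul, he1, one_mul]; exact hηS
  have hD' : Valued.v (e * (1 + ηD) - e) ≤ Valued.v ϖ ^ mstarOfRecord d := by
    rw [show e * (1 + ηD) - e = e * ηD by ring, map_mul, he1, one_mul]; exact hηD
  -- the clean scalar and its twist read like `e` and `c·e` at level `m*`
  have hDe : valueSetMod σ ϖ (mstarOfRecord d) ((e * (1 + ηD)) • xPlus σ ϖ d) = valueSetMod σ ϖ (mstarOfRecord d) (e • xPlus σ ϖ d) :=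
    valueSetMod_smul_xPlus_eq_of_v_sub_le hvσ hϖ hd _ hD'
  have hcDe : valueSetMod σ ϖ (mstarOfRecord d) ((c * (e * (1 + ηD))) • xPlus σ ϖ d) = valueSetMod σ ϖ (mstarOfRecord d) ((c * e) • xPlus σ ϖ d) := by
    refine valueSetMod_smul_xPlus_eq_of_v_sub_le hvσ hϖ hd _ ?_
    rw [← mul_sub, map_mul, hc1, one_mul]
    exact hD'
  refine ⟨?_, ?_⟩
  · rw [hcDe]
    exact valueSetMod_smul_xPlus_eq_twist_of_v_sub_eq_shell' hD h2v hq hσe he1 hS hσc hc1 hcN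
  · rw [hDe]
    exact valueSetMod_smul_xPlus_ne_of_v_sub_eq_shell' hD h2v hq hσe he1 hS

end Summit.HodgeConjecture.HodgeConjecture.Cruxes.H413.F0P3cDyRamLabelShellFlipCardTwo

end
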